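import Summits.CriticalPhenomena.PercolationContinuityZ3.Theorems.PercNearOneGluingNoHeavyQuantConvHeavy
import Summits.CriticalPhenomena.PercolationContinuityZ3.Theorems.PercNearOneGluingNoHeavyQuantLawDecUsageMonge
import Summits.CriticalPhenomena.PercolationContinuityZ3.Theorems.PercNearOneGluingNoHeavyQuantLawDECFarSplit
import HarnessLib

/-!
# QUANT lane R8, T-DEC: DEEP LOWS RIDE ON THE GIANTS — a two-layer giant bound for one DEC law (the far row at every dominant layer as
# the special case `i′ = i`), and the bookkeeping of convolution tails (part 1 of 2; part 2 is `…QuantConvDominant`)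

builds on p205010 (kernel theorem, internal audit signed; external expert review pending)

Support file (`--supports stmt-CriticalPhenomena-4575`), QUANT lane seat prim-quant-arm-2 (gen 34), rung R8 of
`run/shared/lean/prim/quant/LADDER.md`.  Theorems only (no definitions), standard axioms, no sorries.  Vocabulary: `LawDec.DECAt`
(`…QuantLawDEC`), the flow form `flowAtT_of_decAtT` / `usage_giant_eq` (`…QuantLawDecFlows`, `…QuantLawDecUsageMonge`), Theorem A
`decAt_of_top_le`, `LawDec.lconv` (`…QuantSDEC`).

THE TWO-LAYER GIANT BOUND (`deepLows_le_giants`).  `μ` a top-affordable probability law on `{0..M}` (mean `T`, `y·M ≤ T`, `0 < y < 1`)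
that is DEC(j′) at every layer `j′ < M`; layers `i′ ≤ i` with `i + i′ < T`.  Then **`y·μ{h ≤ i′} ≤ (1−y)·μ{h > i}`**: in any flow witness
of DEC(i) (which exists also for `i ≥ M`, by Theorem A) every atom `l ≤ i′` is a low (`2l ≤ i + i′ < T`) and NO mid `m ≤ i` is compatible
with it (`l + m ≤ i′ + i < T`), so it is shipped entirely to the giants `h > i` at rate `y/(1−y)`, within their mass.  `i′ = i` is the far row
`y ≤ μ{h > i}` at every dominant layer `2i < T` (`tail_ge_of_decAt_all`).  Used by part 2 (`lconv_tail_ge_of_hdecAtT`: at a dominant layer of a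
convolution ONE heavy factor suffices) with `i = j − lo`, `i′ = j − hi` for a heavy credit pair `{lo, hi}` of the other factor.
Also here: the tail of a convolution above a layer as a double indicator sum (`conv_tail_eq`) and the tail weight of one two-point component
(`sum_ite_TP`).
HONEST STATUS: tools; `ConvClosedT`, `SDECConvClosed`, `SingleGateConvClosed`, `TreeDEC`, `FarTreeRow` remain OPEN; the RATE class log\* and the
honest sentence of `run/shared/lean/prim/quant/README.md` are unchanged.

* `LawDec.conv_tail_eq`, `LawDec.sum_ite_TP`, `LawDec.sum_le_add_sum_gt`, `LawDec.sum_gt_antitone`, `LawDec.lawMean_le_top` — bookkeeping.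
* **`LawDec.deepLows_le_giants`**, `LawDec.tail_ge_of_decAt_all`.

[this work]; DEC rules ARCH-TREES-G49 §2.2 / DEC-TAMP-G50 §3.1, §3.3 (this lane).  Nothing here is cited as a published result.  The gluing rows
served [cite: KozmaNitzan2024, Conjecture 3 (p. 15)]; product measure [cite: Grimmett1999, §1.3 p. 10].
-/

noncomputable section

namespace Summit.CriticalPhenomena.PercolationContinuityZ3.Theorems

namespace Quant

open Finset

/-- the two-point law `{lo, hi; g}` (as in `…QuantLawDEC`) -/
local notation3 "TP[" lo ", " hi ", " g ", " h "]" =>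
  (g : ℝ) * (if (h : ℕ) = (hi : ℕ) then (1 : ℝ) else 0) + (1 - (g : ℝ)) * (if (h : ℕ) = (lo : ℕ) then (1 : ℝ) else 0)

namespace LawDec

/-! ### Bookkeeping: tails of a convolution -/

/-- **the tail of a convolution above `j`** as a double indicator sum: `Σ_{j < h ≤ M₁+M₂} lconv μ₁ μ₂ h = Σ_{i ≤ M₁} Σ_{k ≤ M₂} [j+1 ≤ i+k]·μ₁ i·μ₂ k`.
[this work] -/
theorem conv_tail_eq (M₁ M₂ j : ℕ) (μ₁ μ₂ : ℕ → ℝ) :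
    ∑ h ∈ Finset.Ico (j + 1) (M₁ + M₂ + 1), lconv M₁ M₂ μ₁ μ₂ h
      = ∑ i ∈ Finset.range (M₁ + 1), ∑ k ∈ Finset.range (M₂ + 1), (if j + 1 ≤ i + k then μ₁ i * μ₂ k else 0) := by
  simp only [lconv]
  rw [Finset.sum_comm]
  refine Finset.sum_congr rfl fun i hi => ?_
  rw [Finset.sum_comm]
  refine Finset.sum_congr rfl fun k hk => ?_
  rw [Finset.mem_range] at hi hk
  rw [Finset.sum_ite_eq (Finset.Ico (j + 1) (M₁ + M₂ + 1)) (i + k)]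
  by_cases hjk : j + 1 ≤ i + k
  · rw [if_pos (Finset.mem_Ico.2 ⟨hjk, by omega⟩), if_pos hjk]
  · rw [if_neg (fun hm => hjk (Finset.mem_Ico.1 hm).1), if_neg hjk]

/-- **the tail weight of one two-point component**: `Σ_{k ≤ M₂} [j+1 ≤ i+k]·TP[lo,hi,g](k) = g·[j+1 ≤ i+hi] + (1−g)·[j+1 ≤ i+lo]`
(`lo, hi ≤ M₂`). [this work] -/
theorem sum_ite_TP (M₂ j i lo hi : ℕ) (g : ℝ) (hlo : lo ≤ M₂) (hhi : hi ≤ M₂) :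
    ∑ k ∈ Finset.range (M₂ + 1), (if j + 1 ≤ i + k then TP[lo, hi, g, k] else 0)
      = g * (if j + 1 ≤ i + hi then (1 : ℝ) else 0) + (1 - g) * (if j + 1 ≤ i + lo then (1 : ℝ) else 0) := by
  -- split the component into its two atoms
  have e : ∀ k, (if j + 1 ≤ i + k then TP[lo, hi, g, k] else 0)
      = (if k = hi then g * (if j + 1 ≤ i + hi then (1 : ℝ) else 0) else 0)
        + (if k = lo then (1 - g) * (if j + 1 ≤ i + lo then (1 : ℝ) else 0) else 0) := by
    intro k
    have e1 : (if j + 1 ≤ i + k then g * (if k = hi then (1 : ℝ) else 0) else 0)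
        = (if k = hi then g * (if j + 1 ≤ i + hi then (1 : ℝ) else 0) else 0) := by
      by_cases hk : k = hi
      · subst hk; simp only [if_true]; split_ifs <;> ring
      · simp only [hk, if_false]; split_ifs <;> ring
    have e2 : (if j + 1 ≤ i + k then (1 - g) * (if k = lo then (1 : ℝ) else 0) else 0)
        = (if k = lo then (1 - g) * (if j + 1 ≤ i + lo then (1 : ℝ) else 0) else 0) := by
      by_cases hk : k = lo
      · subst hk; simp only [if_true]; split_ifs <;> ring
      · simp only [hk, if_false]; split_ifs <;> ring
    rw [← e1, ← e2]
    split_ifs <;> ring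
  rw [Finset.sum_congr rfl (fun k _ => e k), Finset.sum_add_distrib,
    Finset.sum_ite_eq' (Finset.range (M₂ + 1)) hi, if_pos (Finset.mem_range.2 (by omega)),
    Finset.sum_ite_eq' (Finset.range (M₂ + 1)) lo, if_pos (Finset.mem_range.2 (by omega))]

/-- the mass at or below a layer plus the mass strictly above it is the total mass. [this work] -/
theorem sum_le_add_sum_gt (M i : ℕ) (μ : ℕ → ℝ) :
    ∑ h ∈ Finset.range (M + 1), (if h ≤ i then μ h else 0) + ∑ h ∈ Finset.range (M + 1), (if i + 1 ≤ h then μ h else 0)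
      = ∑ h ∈ Finset.range (M + 1), μ h := by
  rw [← Finset.sum_add_distrib]
  refine Finset.sum_congr rfl fun h _ => ?_
  by_cases hh : h ≤ i
  · rw [if_pos hh, if_neg (by omega), add_zero]
  · rw [if_neg hh, if_pos (by omega), zero_add]

/-- the mass strictly above a layer is antitone in the layer (`μ ≥ 0`). [this work] -/
theorem sum_gt_antitone (M i i' : ℕ) (μ : ℕ → ℝ) (hμ0 : ∀ h, 0 ≤ μ h) (hii : i' ≤ i) :
    ∑ h ∈ Finset.range (M + 1), (if i + 1 ≤ h then μ h else 0) ≤ ∑ h ∈ Finset.range (M + 1), (if i' + 1 ≤ h then μ h else 0) := by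
  refine Finset.sum_le_sum fun h _ => ?_
  by_cases h1 : i + 1 ≤ h
  · rw [if_pos h1, if_pos (by omega)]
  · rw [if_neg h1]; split_ifs; exacts [hμ0 h, le_rfl]

/-- the mean of a probability law on `{0..M}` is at most `M`. [this work] -/
theorem lawMean_le_top (M : ℕ) (μ : ℕ → ℝ) (hμ0 : ∀ h, 0 ≤ μ h) (hμ1 : ∑ h ∈ Finset.range (M + 1), μ h = 1) :
    ∑ h ∈ Finset.range (M + 1), (h : ℝ) * μ h ≤ M := by
  calc ∑ h ∈ Finset.range (M + 1), (h : ℝ) * μ h ≤ ∑ h ∈ Finset.range (M + 1), (M : ℝ) * μ h := by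
        refine Finset.sum_le_sum fun h hh => ?_
        rw [Finset.mem_range] at hh
        exact mul_le_mul_of_nonneg_right (by exact_mod_cast (by omega : h ≤ M)) (hμ0 h)
    _ = M := by rw [← Finset.mul_sum, hμ1, mul_one]

/-! ### The two-layer giant bound -/

/-- **DEEP LOWS RIDE ON THE GIANTS (two-layer giant bound).**  `μ` a probability law on `{0..M}` (mean `T`, top-affordable `y·M ≤ T`,
`0 < y < 1`) that is DEC(j′) at every layer `j′ < M`; layers `i′ ≤ i` with `i + i′ < T`.  Then `y·μ{h ≤ i′} ≤ (1−y)·μ{h > i}`: in a flow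
witness of DEC(i) (which exists also for `i ≥ M`, by Theorem A) every atom `l ≤ i′` is a low (`2l ≤ i + i′ < T`) and no mid `m ≤ i` is
compatible with it (`l + m ≤ i′ + i < T`), so it is shipped entirely to the giants `h > i` at rate `y/(1−y)`, within their mass.  For `i′ = i`
(`2i < T`) this is the far row at the dominant layer `i`. [this work] -/
theorem deepLows_le_giants (y T : ℝ) (M i i' : ℕ) (μ : ℕ → ℝ) (hy0 : 0 < y) (hy1 : y < 1)
    (hμ0 : ∀ h, 0 ≤ μ h) (hμM : ∀ h, M < h → μ h = 0) (hμ1 : ∑ h ∈ Finset.range (M + 1), μ h = 1)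
    (hT : ∑ h ∈ Finset.range (M + 1), (h : ℝ) * μ h = T) (hta : y * (M : ℝ) ≤ T)
    (hdec : ∀ j', j' < M → DECAt y j' M μ) (hii : i' ≤ i) (hdeep : (i : ℝ) + i' < T) :
    y * ∑ h ∈ Finset.range (M + 1), (if h ≤ i' then μ h else 0)
      ≤ (1 - y) * ∑ h ∈ Finset.range (M + 1), (if i + 1 ≤ h then μ h else 0) := by
  classical
  have h1y : 0 < 1 - y := by linarith
  -- DEC at layer `i` (Theorem A above the top)
  have hdecAt : DECAt y i M μ := by
    by_cases hiM : i < M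
    · exact hdec i hiM
    · refine decAt_of_top_le M μ hμ0 hμM hμ1 y hy1 (fun h hh => ?_) i (not_lt.1 hiM)
      have hhM : h ≤ M := by
        by_contra hc
        exact (lt_irrefl (0 : ℝ)) (lt_of_lt_of_eq hh (hμM h (not_le.1 hc)))
      rw [hT]
      calc y * (h : ℝ) ≤ y * (M : ℝ) := mul_le_mul_of_nonneg_left (by exact_mod_cast hhM) hy0.le
        _ ≤ T := hta
  obtain ⟨f, hf0, hsupp, hrow, hcol⟩ := flowAtT_of_decAtT y _ i M μ hy0 hy1 hdecAt
  -- atoms at or below `i′` are lows of layer `i` and ride only on giants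
  have hlow : ∀ l, l ≤ i' → l ≤ i ∧ 2 * (l : ℝ) < ∑ h ∈ Finset.range (M + 1), (h : ℝ) * μ h := by
    intro l hl
    refine ⟨hl.trans hii, ?_⟩
    have e1 : (l : ℝ) ≤ i' := by exact_mod_cast hl
    have e2 : (i' : ℝ) ≤ i := by exact_mod_cast hii
    rw [hT]; linarith
  have hgiant : ∀ l h, l ≤ i' → 0 < f l h → i + 1 ≤ h := by
    intro l h hl hpos
    obtain ⟨_, _, _, habs⟩ := hsupp l h hpos
    rcases habs with hg | hm
    · exact hg
    · by_contra hc
      have e1 : (h : ℝ) ≤ i := by exact_mod_cast (by omega : h ≤ i)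
      have e2 : (l : ℝ) ≤ i' := by exact_mod_cast hl
      rw [hT] at hm
      linarith
  -- the mass at or below `i′`, as giant-routed flow
  have hmass : ∀ l ∈ Finset.range (M + 1), (if l ≤ i' then μ l else 0)
      = ∑ h ∈ Finset.range (M + 1), (if i + 1 ≤ h then (if l ≤ i' then f l h else 0) else 0) := by
    intro l _
    by_cases hl : l ≤ i'
    · rw [if_pos hl, ← hrow l (hlow l hl).1 (hlow l hl).2]
      refine Finset.sum_congr rfl fun h _ => ?_
      rw [if_pos hl]
      by_cases hg : i + 1 ≤ h
      · rw [if_pos hg]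
      · rw [if_neg hg]
        rcases (hf0 l h).eq_or_lt with hz | hpos
        · exact hz.symm
        · exact absurd (hgiant l h hl hpos) hg
    · rw [if_neg hl]
      symm
      refine Finset.sum_eq_zero fun h _ => ?_
      rw [if_neg hl]; split_ifs <;> rfl
  -- the giants carry it at rate `y/(1−y)`
  have hcap : ∀ h ∈ Finset.range (M + 1), y * ∑ l ∈ Finset.range (M + 1), (if i + 1 ≤ h then (if l ≤ i' then f l h else 0) else 0)
      ≤ (1 - y) * (if i + 1 ≤ h then μ h else 0) := by
    intro h hh
    rw [Finset.mem_range] at hh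
    by_cases hg : i + 1 ≤ h
    · simp only [if_pos hg]
      have hc := hcol h (by omega) (Or.inl hg)
      have hu : ∀ l ∈ Finset.range (i + 1), usage y (∑ h ∈ Finset.range (M + 1), (h : ℝ) * μ h) i l h * f l h
          = y / (1 - y) * f l h := fun l _ => by rw [usage_giant_eq _ _ _ _ _ hg]
      rw [Finset.sum_congr rfl hu, ← Finset.mul_sum] at hc
      -- the lows `≤ i′` are among the lows `≤ i`
      have hsub : ∑ l ∈ Finset.range (M + 1), (if l ≤ i' then f l h else 0) ≤ ∑ l ∈ Finset.range (i + 1), f l h := by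
        rw [← Finset.sum_filter]
        refine Finset.sum_le_sum_of_subset_of_nonneg (fun l hl => ?_) (fun l _ _ => hf0 l h)
        rw [Finset.mem_filter, Finset.mem_range] at hl
        exact Finset.mem_range.2 (by omega)
      have hmul : y / (1 - y) * ∑ l ∈ Finset.range (M + 1), (if l ≤ i' then f l h else 0) ≤ μ h :=
        (mul_le_mul_of_nonneg_left hsub (div_nonneg hy0.le h1y.le)).trans hc
      rw [div_mul_eq_mul_div, div_le_iff₀ h1y] at hmul
      linarith
    · simp only [if_neg hg]
      rw [Finset.sum_const_zero, mul_zero, mul_zero]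
  calc y * ∑ h ∈ Finset.range (M + 1), (if h ≤ i' then μ h else 0)
      = y * ∑ l ∈ Finset.range (M + 1), ∑ h ∈ Finset.range (M + 1),
          (if i + 1 ≤ h then (if l ≤ i' then f l h else 0) else 0) := by rw [Finset.sum_congr rfl hmass]
    _ = ∑ h ∈ Finset.range (M + 1), y * ∑ l ∈ Finset.range (M + 1),
          (if i + 1 ≤ h then (if l ≤ i' then f l h else 0) else 0) := by rw [Finset.sum_comm, Finset.mul_sum]
    _ ≤ ∑ h ∈ Finset.range (M + 1), (1 - y) * (if i + 1 ≤ h then μ h else 0) := Finset.sum_le_sum hcap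
    _ = (1 - y) * ∑ h ∈ Finset.range (M + 1), (if i + 1 ≤ h then μ h else 0) := by rw [← Finset.mul_sum]

/-- **THE FAR ROW AT EVERY DOMINANT LAYER of a top-affordable probability law DEC at every layer below its top**: `2i < T ⟹ y ≤ μ{h > i}`
(`deepLows_le_giants` with `i′ = i`). [this work] -/
theorem tail_ge_of_decAt_all (y T : ℝ) (M i : ℕ) (μ : ℕ → ℝ) (hy0 : 0 < y) (hy1 : y < 1)
    (hμ0 : ∀ h, 0 ≤ μ h) (hμM : ∀ h, M < h → μ h = 0) (hμ1 : ∑ h ∈ Finset.range (M + 1), μ h = 1)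
    (hT : ∑ h ∈ Finset.range (M + 1), (h : ℝ) * μ h = T) (hta : y * (M : ℝ) ≤ T)
    (hdec : ∀ j', j' < M → DECAt y j' M μ) (hdom : 2 * (i : ℝ) < T) :
    y ≤ ∑ h ∈ Finset.range (M + 1), (if i + 1 ≤ h then μ h else 0) := by
  have h := deepLows_le_giants y T M i i μ hy0 hy1 hμ0 hμM hμ1 hT hta hdec le_rfl (by linarith)
  have hsplit := sum_le_add_sum_gt M i μ
  rw [hμ1] at hsplit
  nlinarith [hsplit, h]

end LawDec

end Quant

end Summit.CriticalPhenomena.PercolationContinuityZ3.Theorems
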